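/-
HONEST FRAMING: certified error envelopes and provably optimal rounding/accumulation schemes for
low-precision formats under stated cost models; every table by two implementations; no hardware
or vendor claims.
-/
import Mathlib.Data.Finset.Powerset
import Summits.Ventures.CertifiedArithmetic.LowPrec.OptDemotionTreeWitness

/-!
# The demotion law (Theorem T8), part 8a: the BIT-ROUTING value with formal weights (opt gen 13, R16–R18)

OPTIMA.md §B T8(b)(iii⁗) (R16)–(R18) (opt seat gen 13).  A BIT ROUTING of a summation tree hands
every bit of the computed root value — a finite set `S` of binary exponents with
`max S - min S ≤ q - 1`, so that `Σ_{e ∈ S} 2^e` is a `q`-bit float — down the tree: an internal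
node holding a nonempty configuration `S` with top exponent `e₀ = max S` may inject ONE fresh bit
`e₀ - q` (the half ulp `u · ufp`, `u = 2^-q`) and splits `S` (or `S ∪ {e₀ - q}`) into two routable
configurations for its children; it scores `ufp = 2^e₀`.  `BR_t(S)` is the best total score over
all routings; routings are the carry-free flows of the σ-flow model (R16), so `BR_t ≤ W_t`, and the
ROUTING CONJECTURE (R18, open, certified on every instance computed) says `W_t = BR_t`.

THIS FILE defines the routing value with a FORMAL WEIGHT `W : ℤ → ℚ` in place of `2^e`:
`treeBRw q W t S` (part 8c specialises to `W e = 2^e`).  The formal weight turns opt's "family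
form" of a routing score (R17(a),(b): one combinatorial coefficient per bit family, value
independence) into one-line structural facts — `treeBRw` is SUBLINEAR and nonnegatively homogeneous
in `W` (`treeBRw_add_le`, `treeBRw_smul`, `treeBRw_sum_le`) and sees `W` only on a set of
exponents closed under `e ↦ e - q` containing `S` (`treeBRw_congr`) — which part 8c combines into
THEOREM R17 (`u · BR_t(S) ≤ 2^e₀ · (treeQf u t x - 1 - x)`, every tree).  Part 8a′
(`OptDemotionRoutingSingle`): weights with `W (e - q) = u · W e` and the value of a single bit
`treeBRw q W t {e} = W e · A_t`, `1 + u · A_t = M_t`.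
-/

namespace Summit.Ventures.CertifiedArithmetic.LowPrec.Opt

open Literature.ComputerArithmetic.JeannerodRump2018
open Literature.ComputerArithmetic.JeannerodRump2018.SumTree

/-! ## Routable configurations, splits, and the routing value -/

/-- A configuration of bits (a finite set of binary exponents) is ROUTABLE in precision `q` if it
fits in `q` consecutive binary places (`Σ_{e ∈ S} 2^e` is then a `q`-bit float, or `S = ∅`). -/
def Routable (q : ℕ) (S : Finset ℤ) : Prop := ∀ e ∈ S, ∀ e' ∈ S, e ≤ e' + ((q : ℤ) - 1)

/-- Routability is decidable. -/
instance Routable.instDecidable (q : ℕ) (S : Finset ℤ) : Decidable (Routable q S) := by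
  unfold Routable; infer_instance

/-- Subsets of routable configurations are routable. -/
theorem Routable.mono {q : ℕ} {S T : Finset ℤ} (h : Routable q T) (hST : S ⊆ T) : Routable q S :=
  fun e he e' he' => h e (hST he) e' (hST he')

/-- The empty configuration is routable. -/
theorem routable_empty (q : ℕ) : Routable q ∅ := fun e he => absurd he (Finset.notMem_empty e)

/-- A single bit is routable (`q ≥ 1`). -/
theorem routable_singleton {q : ℕ} (hq : 1 ≤ q) (e : ℤ) : Routable q {e} := by
  intro a ha b hb
  rw [Finset.mem_singleton] at ha hb
  subst ha; subst hb
  have : (1 : ℤ) ≤ q := by exact_mod_cast hq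
  linarith

/-- A bit and its injected half ulp `e - q` never travel together. -/
theorem not_routable_of_mem_mem {q : ℕ} {S : Finset ℤ} (h : Routable q S) {e : ℤ} (he : e ∈ S)
    (he' : e - q ∈ S) : False := by
  have := h e he (e - q) he'
  linarith

/-- The VALID SPLITS at a node holding `S` with top exponent `e₀`: ordered pairs `(A, B)` of routable
configurations partitioning `S`, or `S` together with the injected bit `e₀ - q`. -/
def splits (q : ℕ) (S : Finset ℤ) (e₀ : ℤ) : Finset (Finset ℤ × Finset ℤ) :=
  ((S.powerset.image fun A => (A, S \ A)) ∪
    ((insert (e₀ - q) S).powerset.image fun A => (A, insert (e₀ - q) S \ A))).filter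
    fun AB => Routable q AB.1 ∧ Routable q AB.2

/-- Membership in `splits`. -/
theorem mem_splits {q : ℕ} {S : Finset ℤ} {e₀ : ℤ} {AB : Finset ℤ × Finset ℤ} :
    AB ∈ splits q S e₀ ↔
      ((AB.1 ⊆ S ∧ AB.2 = S \ AB.1) ∨
        (AB.1 ⊆ insert (e₀ - q) S ∧ AB.2 = insert (e₀ - q) S \ AB.1)) ∧
      (Routable q AB.1 ∧ Routable q AB.2) := by
  simp only [splits, Finset.mem_filter, Finset.mem_union, Finset.mem_image, Finset.mem_powerset]
  constructor
  · rintro ⟨h | h, hr⟩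
    · obtain ⟨A, hA, rfl⟩ := h
      exact ⟨Or.inl ⟨hA, rfl⟩, hr⟩
    · obtain ⟨A, hA, rfl⟩ := h
      exact ⟨Or.inr ⟨hA, rfl⟩, hr⟩
  · rintro ⟨h | h, hr⟩
    · exact ⟨Or.inl ⟨AB.1, h.1, Prod.ext rfl h.2.symm⟩, hr⟩
    · exact ⟨Or.inr ⟨AB.1, h.1, Prod.ext rfl h.2.symm⟩, hr⟩

/-- A pair `(A, T \ A)` with `A ⊆ T`, `T = S` or `T = S ∪ {e₀ - q}`, both parts routable, is a
valid split. -/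
theorem mk_mem_splits {q : ℕ} {S : Finset ℤ} {e₀ : ℤ} {A : Finset ℤ}
    (h : A ⊆ S ∨ A ⊆ insert (e₀ - q) S) (hA : Routable q A)
    (hB : A ⊆ S → Routable q (S \ A)) (hB' : ¬ A ⊆ S → Routable q (insert (e₀ - q) S \ A)) :
    (A ⊆ S ∧ (A, S \ A) ∈ splits q S e₀) ∨
      (¬ A ⊆ S ∧ (A, insert (e₀ - q) S \ A) ∈ splits q S e₀) := by
  by_cases hAS : A ⊆ S
  · exact Or.inl ⟨hAS, mem_splits.2 ⟨Or.inl ⟨hAS, rfl⟩, hA, hB hAS⟩⟩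
  · rcases h with h | h
    · exact absurd h hAS
    · exact Or.inr ⟨hAS, mem_splits.2 ⟨Or.inr ⟨h, rfl⟩, hA, hB' hAS⟩⟩

/-- What a valid split consists of: both parts inside `S ∪ {e₀ - q}`, disjoint, covering `S`, routable. -/
theorem of_mem_splits {q : ℕ} {S : Finset ℤ} {e₀ : ℤ} {A B : Finset ℤ} (h : (A, B) ∈ splits q S e₀) :
    A ⊆ insert (e₀ - q) S ∧ B ⊆ insert (e₀ - q) S ∧ Disjoint A B ∧ S ⊆ A ∪ B ∧
      Routable q A ∧ Routable q B := by
  obtain ⟨h1, hA, hB⟩ := mem_splits.1 h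
  refine ⟨?_, ?_, ?_, ?_, hA, hB⟩
  · rcases h1 with ⟨h, -⟩ | ⟨h, -⟩
    · exact h.trans (Finset.subset_insert _ _)
    · exact h
  · rcases h1 with ⟨-, h⟩ | ⟨-, h⟩
    · simp only at h; rw [h]; exact Finset.sdiff_subset.trans (Finset.subset_insert _ _)
    · simp only at h; rw [h]; exact Finset.sdiff_subset
  · rcases h1 with ⟨-, h⟩ | ⟨-, h⟩ <;> (simp only at h; rw [h]; exact Finset.disjoint_sdiff)
  · rcases h1 with ⟨hs, h⟩ | ⟨hs, h⟩
    · simp only at h hs; rw [h, Finset.union_sdiff_of_subset hs]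
    · simp only at h hs; rw [h, Finset.union_sdiff_of_subset hs]; exact Finset.subset_insert _ _

/-- THE ROUTING VALUE WITH FORMAL WEIGHT `W` (a leaf scores `0`; a node holding `S ≠ ∅` scores
`W (max S)` plus its best valid split; `W e = 2^e` gives opt's `BR_t`). -/
def treeBRw (q : ℕ) (W : ℤ → ℚ) : SumTree → Finset ℤ → ℚ
  | .leaf _, _ => 0
  | .node a b, S =>
      if h : S.Nonempty then
        W (S.max' h) +
          (splits q S (S.max' h)).fold max 0 (fun AB => treeBRw q W a AB.1 + treeBRw q W b AB.2)
      else 0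

/-- A leaf scores nothing. -/
@[simp] theorem treeBRw_leaf (q : ℕ) (W : ℤ → ℚ) (x : ℚ) (S : Finset ℤ) :
    treeBRw q W (.leaf x) S = 0 := by
  simp [treeBRw]

/-- The empty configuration scores nothing. -/
@[simp] theorem treeBRw_empty (q : ℕ) (W : ℤ → ℚ) : ∀ t : SumTree, treeBRw q W t ∅ = 0
  | .leaf _ => by simp [treeBRw]
  | .node a b => by simp [treeBRw]

/-- The node rule. -/
theorem treeBRw_node (q : ℕ) (W : ℤ → ℚ) (a b : SumTree) {S : Finset ℤ} (h : S.Nonempty) :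
    treeBRw q W (.node a b) S = W (S.max' h) +
      (splits q S (S.max' h)).fold max 0 (fun AB => treeBRw q W a AB.1 + treeBRw q W b AB.2) := by
  simp [treeBRw, h]

/-- Monotonicity of a `max`-fold in the function. -/
theorem fold_max_le_fold_max {α : Type} {s : Finset α} {f g : α → ℚ} (h : ∀ x ∈ s, f x ≤ g x) :
    s.fold max 0 f ≤ s.fold max 0 g := by
  rw [Finset.fold_max_le]
  refine ⟨(Finset.le_fold_max (0 : ℚ)).2 (Or.inl le_rfl), fun x hx => ?_⟩
  exact (h x hx).trans ((Finset.le_fold_max (g x)).2 (Or.inr ⟨x, hx, le_rfl⟩))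

/-- A `max`-fold from `0` is nonnegative. -/
theorem fold_max_nonneg {α : Type} (s : Finset α) (f : α → ℚ) : 0 ≤ s.fold max 0 f :=
  (Finset.le_fold_max (0 : ℚ)).2 (Or.inl le_rfl)

/-- A `max`-fold from `0` is `0` or attained. -/
theorem fold_max_eq_zero_or_exists {α : Type} (s : Finset α) (f : α → ℚ) :
    s.fold max 0 f = 0 ∨ ∃ x ∈ s, s.fold max 0 f = f x := by
  rcases (Finset.le_fold_max (s.fold max 0 f)).1 le_rfl with h | ⟨x, hx, h⟩
  · exact Or.inl (le_antisymm h (fold_max_nonneg s f))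
  · exact Or.inr ⟨x, hx, le_antisymm h ((Finset.le_fold_max _).2 (Or.inr ⟨x, hx, le_rfl⟩))⟩

/-- Every valid split is dominated by the node value. -/
theorem split_le_treeBRw_node {q : ℕ} {W : ℤ → ℚ} {a b : SumTree} {S : Finset ℤ} (h : S.Nonempty)
    {A B : Finset ℤ} (hAB : (A, B) ∈ splits q S (S.max' h)) :
    W (S.max' h) + (treeBRw q W a A + treeBRw q W b B) ≤ treeBRw q W (.node a b) S := by
  rw [treeBRw_node q W a b h]
  exact add_le_add le_rfl ((Finset.le_fold_max _).2 (Or.inr ⟨(A, B), hAB, le_rfl⟩))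

/-- The node value is at most `W top + c` for any `c ≥ 0` dominating every valid split. -/
theorem treeBRw_node_le {q : ℕ} {W : ℤ → ℚ} {a b : SumTree} {S : Finset ℤ} (h : S.Nonempty) {c : ℚ}
    (hc : 0 ≤ c) (hall : ∀ AB ∈ splits q S (S.max' h), treeBRw q W a AB.1 + treeBRw q W b AB.2 ≤ c) :
    treeBRw q W (.node a b) S ≤ W (S.max' h) + c := by
  rw [treeBRw_node q W a b h]
  exact add_le_add le_rfl ((Finset.fold_max_le _).2 ⟨hc, hall⟩)

/-- The node value is `W top` or `W top +` an attained split. -/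
theorem treeBRw_node_eq {q : ℕ} {W : ℤ → ℚ} {a b : SumTree} {S : Finset ℤ} (h : S.Nonempty) :
    treeBRw q W (.node a b) S = W (S.max' h) ∨
      ∃ AB ∈ splits q S (S.max' h),
        treeBRw q W (.node a b) S = W (S.max' h) + (treeBRw q W a AB.1 + treeBRw q W b AB.2) := by
  rw [treeBRw_node q W a b h]
  rcases fold_max_eq_zero_or_exists (splits q S (S.max' h))
      (fun AB => treeBRw q W a AB.1 + treeBRw q W b AB.2) with h0 | ⟨AB, hAB, hval⟩
  · exact Or.inl (by rw [h0, add_zero])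
  · exact Or.inr ⟨AB, hAB, by rw [hval]⟩

/-- Nonnegative weights give nonnegative values. -/
theorem treeBRw_nonneg {q : ℕ} {W : ℤ → ℚ} (hW : ∀ e, 0 ≤ W e) :
    ∀ (t : SumTree) (S : Finset ℤ), 0 ≤ treeBRw q W t S
  | .leaf _, S => by simp
  | .node a b, S => by
      by_cases h : S.Nonempty
      · rw [treeBRw_node q W a b h]
        exact add_nonneg (hW _) (fold_max_nonneg _ _)
      · rw [Finset.not_nonempty_iff_eq_empty.1 h, treeBRw_empty]

/-! ## Sublinearity and locality in the weight (opt's family form, R17(a)(b)) -/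

/-- The zero weight scores nothing. -/
theorem treeBRw_zero : ∀ (q : ℕ) (t : SumTree) (S : Finset ℤ), treeBRw q (fun _ => 0) t S = 0
  | q, .leaf _, S => by simp
  | q, .node a b, S => by
      by_cases h : S.Nonempty
      · rw [treeBRw_node q _ a b h, zero_add]
        refine le_antisymm ((Finset.fold_max_le _).2 ⟨le_rfl, fun AB _ => ?_⟩) (fold_max_nonneg _ _)
        rw [treeBRw_zero q a, treeBRw_zero q b, add_zero]
      · rw [Finset.not_nonempty_iff_eq_empty.1 h, treeBRw_empty]

/-- NONNEGATIVE HOMOGENEITY in the weight. -/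
theorem treeBRw_smul {q : ℕ} {W : ℤ → ℚ} {c : ℚ} (hc : 0 ≤ c) :
    ∀ (t : SumTree) (S : Finset ℤ), treeBRw q (fun e => c * W e) t S = c * treeBRw q W t S
  | .leaf _, S => by simp
  | .node a b, S => by
      by_cases h : S.Nonempty
      · rw [treeBRw_node q _ a b h, treeBRw_node q W a b h, mul_add]
        congr 1
        refine le_antisymm ?_ ?_
        · refine (Finset.fold_max_le _).2 ⟨mul_nonneg hc (fold_max_nonneg _ _), fun AB hAB => ?_⟩
          rw [treeBRw_smul hc a, treeBRw_smul hc b, ← mul_add]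
          exact mul_le_mul_of_nonneg_left
            ((Finset.le_fold_max _).2 (Or.inr ⟨AB, hAB, le_rfl⟩)) hc
        · rcases fold_max_eq_zero_or_exists (splits q S (S.max' h))
              (fun AB => treeBRw q W a AB.1 + treeBRw q W b AB.2) with h0 | ⟨AB, hAB, hval⟩
          · rw [h0, mul_zero]; exact fold_max_nonneg _ _
          · rw [hval]
            refine (Finset.le_fold_max _).2 (Or.inr ⟨AB, hAB, ?_⟩)
            rw [treeBRw_smul hc a, treeBRw_smul hc b, ← mul_add]
      · rw [Finset.not_nonempty_iff_eq_empty.1 h, treeBRw_empty, treeBRw_empty, mul_zero]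

/-- SUBADDITIVITY in the weight (the same routing scores `W₁ + W₂` as the sum of its two scores). -/
theorem treeBRw_add_le {q : ℕ} {W₁ W₂ : ℤ → ℚ} :
    ∀ (t : SumTree) (S : Finset ℤ),
      treeBRw q (fun e => W₁ e + W₂ e) t S ≤ treeBRw q W₁ t S + treeBRw q W₂ t S
  | .leaf _, S => by simp
  | .node a b, S => by
      by_cases h : S.Nonempty
      · rw [treeBRw_node q _ a b h, treeBRw_node q W₁ a b h, treeBRw_node q W₂ a b h]
        have : (splits q S (S.max' h)).fold max 0
              (fun AB => treeBRw q (fun e => W₁ e + W₂ e) a AB.1 + treeBRw q (fun e => W₁ e + W₂ e) b AB.2)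
            ≤ (splits q S (S.max' h)).fold max 0 (fun AB => treeBRw q W₁ a AB.1 + treeBRw q W₁ b AB.2) +
              (splits q S (S.max' h)).fold max 0 (fun AB => treeBRw q W₂ a AB.1 + treeBRw q W₂ b AB.2) := by
          refine (Finset.fold_max_le _).2 ⟨add_nonneg (fold_max_nonneg _ _) (fold_max_nonneg _ _),
            fun AB hAB => ?_⟩
          have ha := treeBRw_add_le (W₁ := W₁) (W₂ := W₂) (q := q) a AB.1
          have hb := treeBRw_add_le (W₁ := W₁) (W₂ := W₂) (q := q) b AB.2
          have h1 : treeBRw q W₁ a AB.1 + treeBRw q W₁ b AB.2 ≤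
              (splits q S (S.max' h)).fold max 0 (fun AB => treeBRw q W₁ a AB.1 + treeBRw q W₁ b AB.2) :=
            (Finset.le_fold_max _).2 (Or.inr ⟨AB, hAB, le_rfl⟩)
          have h2 : treeBRw q W₂ a AB.1 + treeBRw q W₂ b AB.2 ≤
              (splits q S (S.max' h)).fold max 0 (fun AB => treeBRw q W₂ a AB.1 + treeBRw q W₂ b AB.2) :=
            (Finset.le_fold_max _).2 (Or.inr ⟨AB, hAB, le_rfl⟩)
          linarith
        linarith
      · rw [Finset.not_nonempty_iff_eq_empty.1 h, treeBRw_empty, treeBRw_empty, treeBRw_empty, add_zero]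

/-- SUBLINEARITY over a finite nonnegative combination of weights. -/
theorem treeBRw_sum_le {q : ℕ} {ι : Type} [DecidableEq ι] (s : Finset ι) (c : ι → ℚ)
    (Ws : ι → ℤ → ℚ) (hc : ∀ i ∈ s, 0 ≤ c i) (t : SumTree) (S : Finset ℤ) :
    treeBRw q (fun e => ∑ i ∈ s, c i * Ws i e) t S ≤ ∑ i ∈ s, c i * treeBRw q (Ws i) t S := by
  induction s using Finset.induction_on with
  | empty => simp only [Finset.sum_empty]; rw [treeBRw_zero]
  | @insert i s hi ih =>
      have hci : 0 ≤ c i := hc i (Finset.mem_insert_self i s)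
      have hcs : ∀ j ∈ s, 0 ≤ c j := fun j hj => hc j (Finset.mem_insert_of_mem hj)
      have e1 : (fun e => ∑ j ∈ insert i s, c j * Ws j e) =
          fun e => (fun e => c i * Ws i e) e + (fun e => ∑ j ∈ s, c j * Ws j e) e := by
        funext e; rw [Finset.sum_insert hi]
      rw [e1, Finset.sum_insert hi]
      calc treeBRw q (fun e => (fun e => c i * Ws i e) e + (fun e => ∑ j ∈ s, c j * Ws j e) e) t S
          ≤ treeBRw q (fun e => c i * Ws i e) t S + treeBRw q (fun e => ∑ j ∈ s, c j * Ws j e) t S :=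
            treeBRw_add_le t S
        _ ≤ c i * treeBRw q (Ws i) t S + ∑ j ∈ s, c j * treeBRw q (Ws j) t S := by
            rw [treeBRw_smul hci]; exact add_le_add le_rfl (ih hcs)

/-- LOCALITY: the value on `S` sees the weight only on a set of exponents containing `S` and
closed under `e ↦ e - q` (all bits ever alive are original bits or iterated injections). -/
theorem treeBRw_congr {q : ℕ} {W W' : ℤ → ℚ} {p : ℤ → Prop} (hp : ∀ e, p e → p (e - q))
    (hW : ∀ e, p e → W e = W' e) :
    ∀ (t : SumTree) (S : Finset ℤ), (∀ e ∈ S, p e) → treeBRw q W t S = treeBRw q W' t S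
  | .leaf _, S, _ => by simp
  | .node a b, S, hS => by
      by_cases h : S.Nonempty
      · have htop : p (S.max' h) := hS _ (Finset.max'_mem S h)
        have hins : ∀ e ∈ insert (S.max' h - q) S, p e := by
          intro e he
          rcases Finset.mem_insert.1 he with rfl | he
          · exact hp _ htop
          · exact hS e he
        rw [treeBRw_node q W a b h, treeBRw_node q W' a b h, hW _ htop]
        congr 1
        refine Finset.fold_congr fun AB hAB => ?_
        obtain ⟨hA, hB, -⟩ := of_mem_splits (A := AB.1) (B := AB.2) hAB
        rw [treeBRw_congr hp hW a AB.1 fun e he => hins e (hA he),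
          treeBRw_congr hp hW b AB.2 fun e he => hins e (hB he)]
      · rw [Finset.not_nonempty_iff_eq_empty.1 h, treeBRw_empty, treeBRw_empty]

end Summit.Ventures.CertifiedArithmetic.LowPrec.Opt
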